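import Summits.MatrixMultiplication.OmegaCensus.STPPSmallPatternKernelSearchStab

/-!
# ω-census, `(2,1,1)^6` is infeasible in `ℤ/28` — kernel search (stabiliser normal form), part 57 of 58

HONEST FRAMING (pub-omega census; verbatim): lottery ticket; floor = certified bounds/negative ranges.
Census STRUCTURE bookkeeping of the STPP track (seat pub-omega-eng2 = ENG2, gen 34, on the kernel engine of seat pub-omega-stpp-3 gen 23
with the stabiliser normal form / global mask of `STPPSmallPatternKernelSearchStab.lean`; STRUCTURE row B5, the threshold column
`T1(H) = max {k : (2,1,1)^k ⊆ H}`, lower side of the `k = 6` ORDER LAW `(2,1,1)⁶ ⊆ G ↔ 30 ≤ |G|`), not progress on `ω`: small patterns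
in small groups bound no exponent.

Chunks of the kernel mask search `STPP211Neg.search3 (zcode 28) 6` (`decide +kernel`; ≈ 157 s of kernel time predicted); assembled in
`STPPSmallPatternNone211K6Z28.lean`.  Chunk entries `(d, x1, x2, x3, xg)`: representative `d` of `A₀ = {0, d}`, exclusion masks of the first three levels, global
exclusion mask (`STPPSmallPatternKernelSearchStab.lean`).

References: H. Cohn, R. Kleinberg, B. Szegedy, C. Umans, FOCS 2005 (arXiv:math/0511460), Def. 5.1.  Record: pub-omega HOME
`pub-omega-eng2-g34/` (ENG2's C mirror `k211g.c` of the kernel tree with the level-1 and global exclusion masks — `k211c.c` of gen 33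
validated to the translation count against stpp-3's `k211v3.py` — gives COMPLETE NONE on this cell with 217530258 mask translations over the
canonical first levels; planner `plan3.py`; farm calibration 46 µs per translation; not used by the proofs).
-/

set_option Elab.async false  -- several kernel pieces: elaborate sequentially (memory)

namespace Summit.MatrixMultiplication.OmegaCensus

namespace STPP211Neg

/-- Chunk list 139 of `ℤ/28`, `k = 6` (1959559 mask translations in the mirror ≈ 90 s predicted). -/
def Z28k6.ch139 : List (ℕ × ℕ × ℕ × ℕ × ℕ) :=
  [(14, 268435451, 268435371, 176859691, 176859691)]

/-- Kernel search over chunk list 139 of `ℤ/28`, `k = 6`. -/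
theorem Z28k6.s139 : search3 (zcode 28) 6 Z28k6.ch139 = true := by
  decide +kernel

/-- Chunk list 140 of `ℤ/28`, `k = 6` (1447831 mask translations in the mirror ≈ 67 s predicted). -/
def Z28k6.ch140 : List (ℕ × ℕ × ℕ × ℕ × ℕ) :=
  [(14, 268435451, 268435071, 176859691, 176859691)]

/-- Kernel search over chunk list 140 of `ℤ/28`, `k = 6`. -/
theorem Z28k6.s140 : search3 (zcode 28) 6 Z28k6.ch140 = true := by
  decide +kernel

/-- The chunk lists of this part, concatenated. -/
def Z28k6.part57 : List (ℕ × ℕ × ℕ × ℕ × ℕ) :=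
  Z28k6.ch139 ++ Z28k6.ch140

/-- The kernel search over this part's chunks (assembled). -/
theorem Z28k6.ps57 : search3 (zcode 28) 6 Z28k6.part57 = true := by
  simp only [Z28k6.part57, search3_append, Z28k6.s139, Z28k6.s140, Bool.and_self]

end STPP211Neg

end Summit.MatrixMultiplication.OmegaCensus
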